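import Summits.BirchSwinnertonDyer.BirchSwinnertonDyer.Theorems.GenusKolyvaginAtTwoMazurRubinCor34iSingleton
import Summits.BirchSwinnertonDyer.BirchSwinnertonDyer.Theorems.GenusKolyvaginAtTwoGenusPrimitiveSupplyAtTwoTwistMultiFrame
import HarnessLib

/-!
# Route `GenusKolyvaginAtTwo`, crux #2 `GenusPrimitiveSupplyAtTwo` (stmt-BirchSwinnertonDyer-22136):
# MAZUR–RUBIN 2010 PROP. 3.3 OVER `ℚ` (the `V_T`-free consequences) IS A TREE THEOREM — discharge of the named fact
# `MazurRubin2010.prop33_rat`, for EVERY elliptic `E/ℚ` and every finite `T`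

Width seat `bsd-line-gk2-p4` g12 (cell `bsd-f1-sign2`), sequel of `…MazurRubinCor34iSingleton` (`cor34i_singleton_rat_holds`, `T = {q}`) and
`…TwistMultiFrame` (§82, the `K`-general finite-`T` theorem). THEOREMS ONLY (no definition, no named fact, no `sorry`); helper
`--supports stmt-BirchSwinnertonDyer-22136`; no item of this route is closed by it; BSD is not proved by any of this.

WHAT. `Literature.NumberTheory.EllipticCurves.MazurRubin2010.prop33_rat` (Mazur–Rubin, Invent. Math. 181 (2010), Prop. 3.3, `K = ℚ`, every
`T`-prime with `#E(ℚ_p)[2] = 2`): under the splitting list, with `T` = the ramified primes carrying `2`-torsion locally (each with exactly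
`2` points) and all other ramified primes silent, for every model `W'` of `E^{(d)}`: `#Sel₂(W') ∣ 2^{#T}·#Sel₂(E)`, `#Sel₂(E) ∣ 2^{#T}·#Sel₂(W')`,
and `#T` is even iff `#Sel₂(W')·#Sel₂(E)` is a square. Consumers: gk2-p5's prime-Heegner-twin supply
(`exists_prime_heegnerField_minimalTwin_of_prop33`, `selmer_twin_prime_heegner`, `selmer_twin_DEF_one`, `supply_DEF1_minimalTwin_of_duality (h33)`),
cell -es `SelmerTrivialTwistLocusAtTwo`. This file PROVES it (`MazurRubin2010.prop33_rat_holds`) — no Galois-image hypothesis, no duality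
count beyond one place: the inequalities are the ELEMENTARY transfer bound (§80), the parity is Kramer's congruence for the framed
canonical identification (part 9).

HOW. As in `cor34i_singleton_rat_holds`: the LEAD's dictionary to the four-row menu at the finite places outside `T` and at `∞`;
`T₀ := ` the places over `T` (`Finset.preimage` along `v ↦ p_v`, `#T₀ = #T`); at each `v ∈ T₀`: odd, good, `v(d) = 1`, `#E(ℚ_v)[2] = 2`;
§82; model invariance; `#Sel₂ = 2^s` (`exists_natCard_selmerGroup_eq_pow`) turns `≤` into `∣` and the square into the parity of `#T`.

References: [MazurRubin2010] arXiv:0904.3709 = Invent. Math. 181 (2010): Lemma 2.2 (i), Lemmas 2.9–2.11, Def. 3.1, Prop. 3.3 (DASH copy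
p0008–p0010); [Kramer1981] Thm. 1, Props. 1, 2, 7; [KlagsbrunMazurRubin2013] Thm. 3.9, Lemma 5.2; [MilneADT2006] I Thm. 2.8, 4.10.
-/

set_option linter.dupNamespace false -- tree convention: `Summit.BirchSwinnertonDyer.BirchSwinnertonDyer.Theorems` (summit = sub-problem)
set_option autoImplicit false

noncomputable section

open scoped Classical ContRepresentation

namespace Summit.BirchSwinnertonDyer.BirchSwinnertonDyer.Theorems.GenusKolyTwistTamagawa

open WeierstrassCurve Field NumberField IsDedekindDomain Function Polynomial
open Literature.NumberTheory.EllipticCurves Literature.NumberTheory.GaloisRepresentations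
open Literature.NumberTheory.GaloisRepresentations.IsNonarchimedeanLocalField
open Literature.NumberTheory.GaloisCohomology
open Rat.HeightOneSpectrum
open Summit.BirchSwinnertonDyer.BirchSwinnertonDyer.Theorems.GenusKolyTwistLocal

section Main

open Literature.NumberTheory.QuadraticFields
open Summit.BirchSwinnertonDyer.BirchSwinnertonDyer.Theorems.GenusKolyTwistingPrime (primesEquiv_eq natCast_not_mem_of_not_dvd)
open Summit.BirchSwinnertonDyer.BirchSwinnertonDyer.Theorems.GenusKolyTwistRamified
  (valuation_natCast_eq_exp_neg_one_of_mem closureEmb_geomSqrt_not_mem_maxUnramified_rat)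

/-- **MAZUR–RUBIN 2010 PROP. 3.3 OVER `ℚ` (`V_T`-free consequences) HOLDS** — DISCHARGE of the named fact `MazurRubin2010.prop33_rat`, for
EVERY elliptic `E/ℚ` and every finite set `T` of ramified primes with `#E(ℚ_p)[2] = 2` (all other ramified primes silent), under the
splitting list of Prop. 3.3: `#Sel₂(W') ∣ 2^{#T}·#Sel₂(E)`, `#Sel₂(E) ∣ 2^{#T}·#Sel₂(W')`, `Even #T ↔ IsSquare (#Sel₂(W')·#Sel₂(E))` for every model
`W'` of `E^{(d)}`. [cite: MazurRubin2010, Prop. 3.3 (DASH copy p0009 L63–L83) with Def. 3.1, Lemma 2.2 (i), Lemmas 2.10–2.11]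
[cite: Kramer1981, Thm. 1, Props. 1, 2, 7] [cite: MilneADT2006, I Thm. 2.8, 4.10] -/
theorem _root_.Literature.NumberTheory.EllipticCurves.MazurRubin2010.prop33_rat_holds :
    MazurRubin2010.prop33_rat := by
  intro W _ d hsf hd1 F _ _ h2 hx h1 h2' h3 h4 h5 T hT hT' W' _ hW'
  classical
  have hd0 : d ≠ 0 := fun h ↦ by subst h; exact not_squarefree_zero hsf
  have hdQ : (d : ℚ) ≠ 0 := by exact_mod_cast hd0
  obtain ⟨x, hx⟩ := hx
  haveI hEt := W.isElliptic_quadraticTwist hdQ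
  -- `2` splits in `F`, so `d_F ≡ 1 (mod 8)` and `d_F = d`
  have h8 : NumberField.discr F % 8 = 1 := (Quadratic.ncard_primesOver_two_eq_two_iff h2).mp h3
  have hdiscd : NumberField.discr F = d := by
    rcases discr_eq_or_eq_four_mul h2 hx hsf hd1 with h | h
    · exact h
    · exfalso; omega
  -- ramified odd primes do not split
  have hnotsplit : ∀ (p : ℕ) [Fact p.Prime], p ≠ 2 → (p : ℤ) ∣ NumberField.discr F →
      ((Ideal.span {(p : ℤ)}).primesOver (𝓞 F)).ncard ≠ 2 := by
    intro p _ hp2 hpd h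
    rw [Quadratic.ncard_primesOver_eq_two_iff_legendreSym h2 hp2,
      (legendreSym.eq_zero_iff p _).mpr ((ZMod.intCast_zmod_eq_zero_iff_dvd _ p).mpr hpd)] at h
    exact zero_ne_one h
  -- a prime dividing `d_F` is odd
  have hodd_of_dvd : ∀ p : ℕ, (p : ℤ) ∣ NumberField.discr F → p ≠ 2 := by
    rintro p hpd rfl
    have h2d : (2 : ℤ) ∣ NumberField.discr F := by exact_mod_cast hpd
    omega
  -- the `T`-places
  let f : HeightOneSpectrum (𝓞 ℚ) → ℕ := fun v ↦ ((primesEquiv v : Nat.Primes) : ℕ)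
  have hfinj : Function.Injective f := fun v v' h ↦ primesEquiv.injective (Subtype.ext h)
  let T₀ : Finset (HeightOneSpectrum (𝓞 ℚ)) := T.preimage f (hfinj.injOn)
  have hmemT₀ : ∀ v, v ∈ T₀ ↔ f v ∈ T := fun v ↦ Finset.mem_preimage
  have hcardT₀ : T₀.card = T.card := by
    rw [Finset.card_preimage, Finset.filter_true_of_mem]
    intro p hp
    exact ⟨primesEquiv.symm ⟨p, (hT p hp).1⟩, by simp [f]⟩
  -- facts at a `T`-place `v`: odd, good, `v(d) = 1`, `#W(ℚ_v)[2] = 2`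
  have hTfacts : ∀ v ∈ T₀, ((2 : ℕ) : 𝓞 ℚ) ∉ v.asIdeal ∧ W.HasGoodReductionAt v ∧
      closureEmb (K := ℚ) (v.adicCompletion ℚ) (geomSqrt (d : ℚ)) ∉ maxUnramified (v.adicCompletion ℚ) ∧
      Nat.card (nsmulAddMonoidHom 2 : (W.baseChange (v.adicCompletion ℚ)).toAffine.Point →+ _).ker = 2 := by
    intro v hv
    haveI hF : Fact ((primesEquiv v : Nat.Primes) : ℕ).Prime := ⟨(primesEquiv v).2⟩
    have hq : ((primesEquiv v : Nat.Primes) : ℕ).Prime := (primesEquiv v).2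
    obtain ⟨-, hqdisc, hq2card⟩ := hT (f v) ((hmemT₀ v).mp hv)
    have hqd : (((primesEquiv v : Nat.Primes) : ℕ) : ℤ) ∣ d := hdiscd ▸ hqdisc
    have hq2' : ((primesEquiv v : Nat.Primes) : ℕ) ≠ 2 := hodd_of_dvd _ hqdisc
    have hqv : ((((primesEquiv v : Nat.Primes) : ℕ)) : 𝓞 ℚ) ∈ v.asIdeal := natCast_natGenerator_mem v
    have h2v : ((2 : ℕ) : 𝓞 ℚ) ∉ v.asIdeal :=
      natCast_not_mem_of_not_dvd hq hqv fun h ↦ hq2' ((Nat.prime_dvd_prime_iff_eq hq Nat.prime_two).mp h)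
    refine ⟨h2v, ?_, ?_, ?_⟩
    · -- GOOD reduction at `v`
      rcases W.hasGoodReductionAt_or_hasMultiplicativeReductionAt_or_hasAdditiveReductionAt v with hgood | hmult | hadd
      · exact hgood
      · exfalso
        have hmultp : W.HasMultiplicativeReductionAtPrime ((primesEquiv v : Nat.Primes) : ℕ) :=
          (hasMultiplicativeReductionAtPrime_iff_hasMultiplicativeReductionAt_ringOfIntegers W v).mpr hmult
        rcases Int.even_or_odd (padicValRat ((primesEquiv v : Nat.Primes) : ℕ) W.Δ) with hev | hodd
        · exact hnotsplit _ hq2' hqdisc (h2' _ hmultp hev)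
        · exact h5 _ hmultp hodd hqdisc
      · exfalso
        have hng : ¬ W.HasGoodReductionAtPrime ((primesEquiv v : Nat.Primes) : ℕ) := fun h ↦
          hadd.not_hasGoodReductionAt ((hasGoodReductionAtPrime_iff_hasGoodReductionAt_ringOfIntegers v W).mp h)
        have hnm : ¬ W.HasMultiplicativeReductionAtPrime ((primesEquiv v : Nat.Primes) : ℕ) := fun h ↦
          hadd.not_hasMultiplicativeReductionAt
            ((hasMultiplicativeReductionAtPrime_iff_hasMultiplicativeReductionAt_ringOfIntegers W v).mp h)
        exact hnotsplit _ hq2' hqdisc (h1 _ hng hnm)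
    · -- `v(d) = 1`
      apply closureEmb_geomSqrt_not_mem_maxUnramified_rat v
      obtain ⟨m, hm⟩ := hqd
      have hqm : ¬ (((primesEquiv v : Nat.Primes) : ℕ) : ℤ) ∣ m := fun hm' ↦ by
        have hsq : (((primesEquiv v : Nat.Primes) : ℕ) : ℤ) * ((primesEquiv v : Nat.Primes) : ℕ) ∣ d := by
          rw [hm]; exact mul_dvd_mul_left _ hm'
        have hu := hsf _ hsq
        rw [Int.isUnit_iff] at hu
        rcases hu with hu | hu
        · exact hq.one_lt.ne' (by exact_mod_cast hu)
        · have : (0 : ℤ) ≤ (((primesEquiv v : Nat.Primes) : ℕ) : ℤ) := by positivity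
          omega
      rw [show ((d : ℤ) : ℚ) = ((((primesEquiv v : Nat.Primes) : ℕ) : ℕ) : ℚ) * ((m : ℤ) : ℚ) by rw [hm]; push_cast; ring,
        Valuation.map_mul, valuation_natCast_eq_exp_neg_one_of_mem v hq hqv,
        valuation_intCast_eq_one_of_not_dvd (K := ℚ) (v := v) hq hqv hqm, mul_one]
    · -- `#W(ℚ_v)[2] = 2`
      rw [natCard_ker_nsmul_adicCompletion_eq_padic W v 2]
      exact hq2card
  -- the four-row finite place menu for the pair `(W, W^{(d)})` outside `T₀`
  have hfin : ∀ v : HeightOneSpectrum (𝓞 ℚ), v ∉ T₀ →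
      (∃ s : v.adicCompletion ℚ, s ^ 2 = algebraMap ℚ (v.adicCompletion ℚ) (d : ℚ)) ∨
      (((2 : ℕ) : 𝓞 ℚ) ∉ v.asIdeal ∧
        ¬ 2 ∣ (W.baseChange (v.adicCompletion ℚ)).localTamagawaNumber (v.adicCompletionIntegers ℚ) ∧
        ¬ 2 ∣ ((W.quadraticTwist (d : ℚ)).baseChange (v.adicCompletion ℚ)).localTamagawaNumber
          (v.adicCompletionIntegers ℚ)) ∨
      (((2 : ℕ) : 𝓞 ℚ) ∉ v.asIdeal ∧ W.HasGoodReductionAt v ∧ (W.quadraticTwist (d : ℚ)).HasGoodReductionAt v) ∨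
      (((2 : ℕ) : 𝓞 ℚ) ∉ v.asIdeal ∧
        Nat.card (nsmulAddMonoidHom 2 : (W.baseChange (v.adicCompletion ℚ)).toAffine.Point →+ _).ker = 1 ∧
        Nat.card (nsmulAddMonoidHom 2 :
          ((W.quadraticTwist (d : ℚ)).baseChange (v.adicCompletion ℚ)).toAffine.Point →+ _).ker = 1) := by
    intro v hv
    haveI hF : Fact ((primesEquiv v : Nat.Primes) : ℕ).Prime := ⟨(primesEquiv v).2⟩
    by_cases hsplit : ((Ideal.span {(((primesEquiv v : Nat.Primes) : ℕ) : ℤ)}).primesOver (𝓞 F)).ncard = 2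
    · exact Or.inl (exists_sq_eq_adicCompletion_of_ncard_primesOver_eq_two h2 hx hsf hd1 v hsplit)
    · -- `v` does not split: in particular `v ∤ 2`
      have hp2 : ((primesEquiv v : Nat.Primes) : ℕ) ≠ 2 := by
        intro hp2
        apply hsplit
        rw [hp2]
        exact h3
      have h2v : ((2 : ℕ) : 𝓞 ℚ) ∉ v.asIdeal := fun h ↦ hp2 (primesEquiv_eq Nat.prime_two h)
      rcases W.hasGoodReductionAt_or_hasMultiplicativeReductionAt_or_hasAdditiveReductionAt v with
        hgood | hmult | hadd
      · by_cases hpd : (((primesEquiv v : Nat.Primes) : ℕ) : ℤ) ∣ d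
        · -- ramified prime of good reduction OUTSIDE `T`: SILENT row
          have hpdisc : (((primesEquiv v : Nat.Primes) : ℕ) : ℤ) ∣ NumberField.discr F := hdiscd ▸ hpd
          have hpT : ((primesEquiv v : Nat.Primes) : ℕ) ∉ T := fun h ↦ hv ((hmemT₀ v).mpr h)
          have hW2 := hT' ((primesEquiv v : Nat.Primes) : ℕ) hpdisc hpT
          refine Or.inr (Or.inr (Or.inr ⟨h2v, natCard_ker_nsmul_two_adicCompletion_eq_one_of_forall W v hW2, ?_⟩))
          refine natCard_ker_nsmul_two_adicCompletion_eq_one_of_forall (W.quadraticTwist (d : ℚ)) v ?_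
          have hc : Nat.card {Q : ((W.quadraticTwist (d : ℚ)).baseChange
              ℚ_[((primesEquiv v : Nat.Primes) : ℕ)]).toAffine.Point // 2 • Q = 0} = 1 := by
            rw [natCard_twoTorsion_padic_twist_eq W hdQ (Wd := W.quadraticTwist (d : ℚ)) (C := 1) (one_smul _ _)]
            haveI : Unique {Q : (W.baseChange ℚ_[((primesEquiv v : Nat.Primes) : ℕ)]).toAffine.Point // 2 • Q = 0} :=
              { default := ⟨0, by simp⟩
                uniq := fun Q ↦ Subtype.ext (hW2 Q.1 Q.2) }
            exact Nat.card_unique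
          intro Q hQ
          haveI : Finite {Q : ((W.quadraticTwist (d : ℚ)).baseChange
              ℚ_[((primesEquiv v : Nat.Primes) : ℕ)]).toAffine.Point // 2 • Q = 0} :=
            Nat.finite_of_card_ne_zero (by rw [hc]; norm_num)
          exact congrArg Subtype.val ((Nat.card_eq_one_iff_unique.mp hc).1.elim ⟨Q, hQ⟩ ⟨0, by simp⟩)
        · -- unramified prime of good reduction: BOTH GOOD
          exact Or.inr (Or.inr (Or.inl
            ⟨h2v, hgood, hasGoodReductionAt_quadraticTwist_of_not_dvd_any W v hp2 hpd hgood⟩))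
      · -- multiplicative prime: `ord Δ` even would split, so it is odd and unramified: TAMAGAWA row
        have hmultp : W.HasMultiplicativeReductionAtPrime ((primesEquiv v : Nat.Primes) : ℕ) :=
          (hasMultiplicativeReductionAtPrime_iff_hasMultiplicativeReductionAt_ringOfIntegers W v).mpr hmult
        rcases Int.even_or_odd (padicValRat ((primesEquiv v : Nat.Primes) : ℕ) W.Δ) with hev | hodd
        · exact absurd (h2' _ hmultp hev) hsplit
        · have hpdisc := h5 _ hmultp hodd
          have hpd : ¬ (((primesEquiv v : Nat.Primes) : ℕ) : ℤ) ∣ d := hdiscd ▸ hpdisc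
          refine Or.inr (Or.inl ⟨h2v, ?_, ?_⟩)
          · exact not_two_dvd_localTamagawaNumber_of_mult_of_odd W v hmult
              ((odd_ordMinimalDiscriminant_iff_odd_padicValRat W v).mpr hodd)
          · exact not_two_dvd_localTamagawaNumber_of_mult_of_odd (W.quadraticTwist (d : ℚ)) v
              (hasMultiplicativeReductionAt_quadraticTwist_of_not_dvd_any W v hp2 hpd hmult)
              ((odd_ordMinimalDiscriminant_iff_odd_padicValRat _ v).mpr
                ((odd_padicValRat_Δ_quadraticTwist_iff W hpd).mpr hodd))
      · -- additive prime: it splits by hypothesis — contradiction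
        have hng : ¬ W.HasGoodReductionAtPrime ((primesEquiv v : Nat.Primes) : ℕ) := fun h ↦
          hadd.not_hasGoodReductionAt ((hasGoodReductionAtPrime_iff_hasGoodReductionAt_ringOfIntegers v W).mp h)
        have hnm : ¬ W.HasMultiplicativeReductionAtPrime ((primesEquiv v : Nat.Primes) : ℕ) := fun h ↦
          hadd.not_hasMultiplicativeReductionAt
            ((hasMultiplicativeReductionAtPrime_iff_hasMultiplicativeReductionAt_ringOfIntegers W v).mp h)
        exact absurd (h1 _ hng hnm) hsplit
  -- the infinite place menu
  have hinf : ∀ w : InfinitePlace ℚ,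
      (∃ s : w.Completion, s ^ 2 = algebraMap ℚ w.Completion (d : ℚ)) ∨
      ((∀ y : galoisCohomology (W.localGaloisModule w.Completion) 1, y = 0) ∧
        (∀ y : galoisCohomology ((W.quadraticTwist (d : ℚ)).localGaloisModule w.Completion) 1, y = 0)) := by
    intro w
    rcases lt_or_gt_of_ne W.isUnit_Δ.ne_zero with hneg | hpos
    · right
      have hneg' : (W.quadraticTwist (d : ℚ)).Δ < 0 := by
        rw [quadraticTwist_Δ]
        exact mul_neg_of_pos_of_neg (by positivity) hneg
      exact ⟨fun y ↦ GenusExact.ArchVanishing.localH1_infinitePlace_eq_zero_of_Δ_neg W w hneg y,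
        fun y ↦ GenusExact.ArchVanishing.localH1_infinitePlace_eq_zero_of_Δ_neg _ w hneg' y⟩
    · left
      haveI := h4 hpos
      have hdpos : 0 < d := pos_of_isTotallyReal_of_sq_eq hx hd0
      obtain ⟨m, hm⟩ : ∃ m : ℕ, (m : ℤ) = d := ⟨d.natAbs, Int.natAbs_of_nonneg hdpos.le⟩
      obtain ⟨s, hs⟩ := GenusKolyLowering.exists_sq_eq_infinitePlace_completion w m
      refine ⟨s, ?_⟩
      rw [hs, ← hm, Int.cast_natCast]
  -- §82 for the twist `W^{(d)}` itself, then transport to the given model `W'`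
  obtain ⟨hle₁, hle₂, hsq⟩ := natCard_selmerGroup_twist_bounds_of_menu_frame W (W.quadraticTwist (d : ℚ)) hdQ (C := 1)
    (one_smul _ _) T₀ (fun v hv ↦ (hTfacts v hv).1) (fun v hv ↦ (hTfacts v hv).2.1) (fun v hv ↦ (hTfacts v hv).2.2.1)
    (fun v hv ↦ (hTfacts v hv).2.2.2) hfin hinf
  obtain ⟨C, hC⟩ := hW'
  have hsm := natCard_selmerGroup_smul W' C two_ne_zero
  rw [hC] at hsm
  rw [Nat.cast_ofNat] at hle₁ hle₂ hsq hsm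
  rw [hsm, hcardT₀] at hle₁ hle₂ hsq
  -- `#Sel₂ = 2^s`
  obtain ⟨a, ha⟩ := Literature.NumberTheory.EllipticCurves.exists_natCard_selmerGroup_eq_pow W 2
  obtain ⟨b, hb⟩ := Literature.NumberTheory.EllipticCurves.exists_natCard_selmerGroup_eq_pow W' 2
  have haW : Nat.card (W.selmerGroup 2) = 2 ^ a := ha
  have hbW : Nat.card (W'.selmerGroup 2) = 2 ^ b := hb
  rw [haW, hbW] at hle₁ hle₂ hsq ⊢
  refine ⟨?_, ?_, ?_⟩
  · rw [← pow_add] at hle₁ ⊢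
    exact Nat.pow_dvd_pow 2 ((Nat.pow_le_pow_iff_right Nat.one_lt_two).mp hle₁)
  · rw [← pow_add] at hle₂ ⊢
    exact Nat.pow_dvd_pow 2 ((Nat.pow_le_pow_iff_right Nat.one_lt_two).mp hle₂)
  · rw [← pow_add, ← pow_add, isSquare_two_pow_iff_even] at hsq
    rw [← pow_add, isSquare_two_pow_iff_even]
    constructor
    · intro hT2
      rcases Nat.even_add.mp hsq |>.mpr hT2 with h
      exact h
    · intro hba
      exact (Nat.even_add.mp hsq).mp hba

end Main

end Summit.BirchSwinnertonDyer.BirchSwinnertonDyer.Theorems.GenusKolyTwistTamagawa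

end
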